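import Mathlib
import Literature.Analysis.FluidPDE.VectorCalculus
import Literature.Analysis.FluidPDE.HelicityDensityTransport
import Summits.NavierStokesRegularity.NavierStokesRegularity.Theorems.ThreadingFluxErtelTowerEulerTower
import Summits.NavierStokesRegularity.NavierStokesRegularity.Theorems.ThreadingFluxErtelTowerLaplacianTools
import HarnessLib

/-!
# Crux `PoloidalLiouville` (stmt-NavierStokesRegularity-1222, W1), crux idea «radial-jerk-tower» (ns-idea-15 g7):
# THE VISCOUS LEVEL-TWO LAW of the radial-jerk tower, BY NAME

Support file (`--supports stmt-NavierStokesRegularity-1222`, helper).  Experiment cell `ns-wall-extremal`, width hand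
ns-wall-eng-5 g6, director KEY-NS #186 («V21 radial-jerk-tower sizes go to eng-5 g6»); critic of record ns-wall-crit-1 g4
(V21 PASS-WITH-PRICE; landing order V21-P3: «`ViscousLevelTwoLaw` to get a Defs twin before a proof» — the twin is
`ThreadingFluxErtelTowerDefs`, p692432).  0 kit.

For a smooth Navier–Stokes flow on an open space-time set `I × U` (`∂ₜv + Dv[v] + ∇p = Δv`, `div v = 0`) that is
unthreaded about `x₀` (`⟪ω, x − x₀⟫ ≡ 0`, `ω = curl v`), with `m = ⟪v, x − x₀⟫` (level 1 of the tower) and `Dₜ = ∂ₜ + v·∇`: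

* `vorticity_transport_viscous` — the local NS vorticity equation `∂ₜω + Dω[v] − Dv[ω] = Δω` (`vorticity_transport` with
  `f = Δv`, local `curl Δ = Δ curl`);
* `viscous_level_one` — LEVEL ONE IS CLEAN: `⟪ω, ∇m⟫ ≡ 0` (Ertel with source at level 0 and
  `⟪Δω, x − x₀⟫ = Δ⟪ω, x − x₀⟫ − 2 div ω = 0`);
* `viscous_level_two` — `⟪ω, ∇((Dₜ − Δ) m)⟫ = 2 Σᵢⱼ ∂ᵢωⱼ ∂ᵢ∂ⱼm` pointwise on `I × U` (Ertel with source `Δω` at level 1,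
  the Leibniz rule `0 = Δ⟪ω,∇m⟫ = ⟪Δω,∇m⟫ + ⟪ω,Δ∇m⟫ + 2Σᵢ⟪∂ᵢω,∂ᵢ∇m⟫`, and `Δ∇m = ∇Δm`);
* ★ `viscousLevelTwoLaw : ViscousLevelTwoLaw` — the sketch Prop by name.

BOOKING (critic to confirm; sketch Part C words): an exact NECESSARY CONDITION that every smooth unthreaded NS flow satisfies
(«from level 2 on, viscosity turns the algebraic tower into differential constraints on ω»); helper, no rung credit, W1
movement 0; it refutes nothing and proves no wall statement.  `PoloidalLiouville` (1222) / (27585) OPEN; NS regularity NOT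
proved.
-/

-- the summit and its single problem share the name (D-0017 nested layout)
set_option linter.dupNamespace false

noncomputable section

namespace Summit.NavierStokesRegularity.NavierStokesRegularity.Theorems.PoloidalLiouville.ErtelTower

open Set Function Filter Topology Metric
open scoped Topology RealInnerProductSpace InnerProductSpace
open Literature.Analysis.FluidPDE
open Summit.NavierStokesRegularity.NavierStokesRegularity.Theorems.PoloidalLiouville.HorizonTower (E3)

/-! ### The viscous levels of the tower -/

section Viscous

variable {v : ℝ → E3 → E3} {p : ℝ → E3 → ℝ} {x₀ : E3} {I : Set ℝ} {U : Set E3}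

/-- **THE NAVIER–STOKES VORTICITY EQUATION (local)**: for a smooth NS flow on the open `I × U`
(`∂ₜv + Dv[v] + ∇p = Δv`, `div v = 0`), `∂ₜω + Dω[v] − Dv[ω] = Δω` on `I × U` (`vorticity_transport` with `f = Δv` and the
local `curl Δ = Δ curl`). -/
theorem vorticity_transport_viscous (hI : IsOpen I) (hU : IsOpen U)
    (hv : ContDiffOn ℝ (⊤ : ℕ∞) (Function.uncurry v) (I ×ˢ U))
    (hp : ContDiffOn ℝ (⊤ : ℕ∞) (Function.uncurry p) (I ×ˢ U))
    (hns : ∀ t ∈ I, ∀ x ∈ U, deriv (fun s => v s x) t + fderiv ℝ (v t) x (v t x) + gradient (p t) x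
        = Laplacian.laplacian (v t) x)
    (hdiv : ∀ t ∈ I, ∀ x ∈ U, Literature.Analysis.FluidPDE.VectorCalculus.divergence (v t) x = 0) :
    ∀ t ∈ I, ∀ x ∈ U,
      deriv (fun s => curl (v s) x) t + fderiv ℝ (curl (v t)) x (v t x) - fderiv ℝ (v t) x (curl (v t) x)
        = Laplacian.laplacian (curl (v t)) x := by
  intro t ht x hx
  rw [vorticity_transport (f := fun s z => Laplacian.laplacian (v s) z) hI hU hv hp hns hdiv t ht x hx]
  exact curl_laplacian_of_contDiffOn hU (contDiffOn_slice hv ht) hx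

/-- **VISCOUS LEVEL ONE IS CLEAN**: for a smooth unthreaded NS flow on the open `I × U` the loop momentum
`m = ⟪v, x − x₀⟫` is still a vortex-line integral, `⟪ω, ∇m⟫ ≡ 0` (Ertel with source at level `0`:
`0 = Dₜ⟪ω, x − x₀⟫ = ⟪ω, ∇m⟫ + ⟪Δω, x − x₀⟫`, and `⟪Δω, x − x₀⟫ = Δ⟪ω, x − x₀⟫ − 2 div ω = 0`). -/
theorem viscous_level_one (hI : IsOpen I) (hU : IsOpen U)
    (hv : ContDiffOn ℝ (⊤ : ℕ∞) (Function.uncurry v) (I ×ˢ U))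
    (hp : ContDiffOn ℝ (⊤ : ℕ∞) (Function.uncurry p) (I ×ˢ U))
    (hns : ∀ t ∈ I, ∀ x ∈ U, deriv (fun s => v s x) t + fderiv ℝ (v t) x (v t x) + gradient (p t) x
        = Laplacian.laplacian (v t) x)
    (hdiv : ∀ t ∈ I, ∀ x ∈ U, Literature.Analysis.FluidPDE.VectorCalculus.divergence (v t) x = 0)
    (hunthr : ∀ t ∈ I, ∀ x ∈ U, inner ℝ (curl (v t) x) (x - x₀) = 0) :
    ∀ t ∈ I, ∀ x ∈ U, inner ℝ (curl (v t) x) (gradient (fun z => inner ℝ (v t z) (z - x₀)) x) = 0 := by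
  intro t ht x hx
  have hB : ContDiffOn ℝ (⊤ : ℕ∞) (Function.uncurry fun s z => curl (v s) z) (I ×ˢ U) :=
    contDiffOn_curl_uncurry hv hI hU
  have hθ : ContDiffOn ℝ (⊤ : ℕ∞) (Function.uncurry fun (_ : ℝ) (z : E3) => ‖z - x₀‖ ^ 2 / 2) (I ×ˢ U) :=
    contDiffOn_radialJerk hv hI hU x₀ 0
  have hωU : ContDiffOn ℝ (⊤ : ℕ∞) (curl (v t)) U := contDiffOn_slice hB ht
  have hvt2 : ContDiffAt ℝ 2 (v t) x := ((contDiffOn_slice hv ht).contDiffAt (hU.mem_nhds hx)).of_le (by norm_cast)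
  have hE := ertel_commutation (u := v) (B := fun s z => curl (v s) z)
    (θ := fun (_ : ℝ) (z : E3) => ‖z - x₀‖ ^ 2 / 2) hI hU hv hB hθ t ht x hx
  simp only [gradient_radial, deriv_const, zero_add] at hE
  rw [vorticity_transport_viscous hI hU hv hp hns hdiv t ht x hx] at hE
  -- the level-0 quantity `⟪ω, x − x₀⟫` vanishes identically: its time derivative and gradient vanish
  have hev_t : (fun s => inner ℝ (curl (v s) x) (x - x₀)) =ᶠ[𝓝 t] fun _ => (0 : ℝ) := by
    filter_upwards [hI.mem_nhds ht] with s hs using hunthr s hs x hx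
  have hev_x : (fun z => inner ℝ (curl (v t) z) (z - x₀)) =ᶠ[𝓝 x] fun _ => (0 : ℝ) := by
    filter_upwards [hU.mem_nhds hx] with z hz using hunthr t ht z hz
  have h1 : deriv (fun s => inner ℝ (curl (v s) x) (x - x₀)) t = 0 := by
    rw [hev_t.deriv_eq, deriv_const]
  have h2 : gradient (fun z => inner ℝ (curl (v t) z) (z - x₀)) x = 0 := by
    rw [(gradient_congr_nhds hev_x).eq_of_nhds]
    simp [gradient]
  -- `⟪Δω, x − x₀⟫ = Δ⟪ω, x − x₀⟫ − 2 div ω = 0`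
  have h3 : inner ℝ (Laplacian.laplacian (curl (v t)) x) (x - x₀) = 0 := by
    have hL := laplacian_inner_sub_const_of_contDiffOn (B := curl (v t)) hU hωU hx x₀
    have h0 : Laplacian.laplacian (fun y => inner ℝ (curl (v t) y) (y - x₀)) x = 0 := by
      rw [(InnerProductSpace.laplacian_congr_nhds hev_x).eq_of_nhds]
      simp
    have hdc : Literature.Analysis.FluidPDE.VectorCalculus.divergence (curl (v t)) x = 0 :=
      HelicityDensityTransport.divergence_curl_eq_zero_of_contDiffAt hvt2
    linarith
  rw [h1, h2, h3, inner_zero_right] at hE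
  linarith

/-- **THE VISCOUS LEVEL-TWO LAW** (pointwise form): for a smooth unthreaded NS flow on the open `I × U`, with
`m = ⟪v, x − x₀⟫` and `Dₜ = ∂ₜ + v·∇`, `⟪ω, ∇((Dₜ − Δ) m)⟫ = 2 Σᵢⱼ ∂ᵢωⱼ ∂ᵢ∂ⱼm` at every point of `I × U`
(Ertel with source `Δω` at level 1, where `⟪ω, ∇m⟫ ≡ 0` by `viscous_level_one`; then the Leibniz rule
`0 = Δ⟪ω, ∇m⟫ = ⟪Δω, ∇m⟫ + ⟪ω, Δ∇m⟫ + 2Σᵢ⟪∂ᵢω, ∂ᵢ∇m⟫` and `Δ∇m = ∇Δm`). -/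
theorem viscous_level_two (hI : IsOpen I) (hU : IsOpen U)
    (hv : ContDiffOn ℝ (⊤ : ℕ∞) (Function.uncurry v) (I ×ˢ U))
    (hp : ContDiffOn ℝ (⊤ : ℕ∞) (Function.uncurry p) (I ×ˢ U))
    (hns : ∀ t ∈ I, ∀ x ∈ U, deriv (fun s => v s x) t + fderiv ℝ (v t) x (v t x) + gradient (p t) x
        = Laplacian.laplacian (v t) x)
    (hdiv : ∀ t ∈ I, ∀ x ∈ U, Literature.Analysis.FluidPDE.VectorCalculus.divergence (v t) x = 0)
    (hunthr : ∀ t ∈ I, ∀ x ∈ U, inner ℝ (curl (v t) x) (x - x₀) = 0) :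
    ∀ t ∈ I, ∀ x ∈ U,
      inner ℝ (curl (v t) x)
          (gradient (fun z => deriv (fun s => inner ℝ (v s z) (z - x₀)) t
            + inner ℝ (v t z) (gradient (fun y => inner ℝ (v t y) (y - x₀)) z)
            - Laplacian.laplacian (fun y => inner ℝ (v t y) (y - x₀)) z) x)
        = 2 * ∑ i : Fin 3, ∑ j : Fin 3,
            (fderiv ℝ (fun z => (curl (v t) z) j) x (EuclideanSpace.single i 1))
              * (fderiv ℝ (fun z => fderiv ℝ (fun y => inner ℝ (v t y) (y - x₀)) z (EuclideanSpace.single j 1)) x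
                  (EuclideanSpace.single i 1)) := by
  intro t ht x hx
  -- the objects: `ω = curl v`, `m = ⟪v, · − x₀⟫ = θ₁`
  set m : ℝ → E3 → ℝ := fun s z => inner ℝ (v s z) (z - x₀) with hmdef
  have hB : ContDiffOn ℝ (⊤ : ℕ∞) (Function.uncurry fun s z => curl (v s) z) (I ×ˢ U) :=
    contDiffOn_curl_uncurry hv hI hU
  have hm : ContDiffOn ℝ (⊤ : ℕ∞) (Function.uncurry m) (I ×ˢ U) := by
    have h : Function.uncurry m = Function.uncurry (radialJerk v x₀ 1) := by
      funext q; obtain ⟨s, z⟩ := q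
      simp only [Function.uncurry_apply_pair, hmdef, radialJerk_one]
    rw [h]; exact contDiffOn_radialJerk hv hI hU x₀ 1
  have hωU : ContDiffOn ℝ (⊤ : ℕ∞) (curl (v t)) U := contDiffOn_slice hB ht
  have hmU : ContDiffOn ℝ (⊤ : ℕ∞) (m t) U := contDiffOn_slice hm ht
  have hωd : DifferentiableAt ℝ (curl (v t)) x := (hωU.differentiableOn (by simp)).differentiableAt (hU.mem_nhds hx)
  have hgradmU : ContDiffOn ℝ (⊤ : ℕ∞) (gradient (m t)) U := by
    have h : ContDiffOn ℝ (⊤ : ℕ∞) (fderiv ℝ (m t)) U := hmU.fderiv_of_isOpen hU (by simp)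
    exact (InnerProductSpace.toDual ℝ E3).symm.contDiff.comp_contDiffOn h
  have hgradmd : DifferentiableAt ℝ (gradient (m t)) x :=
    (hgradmU.differentiableOn (by simp)).differentiableAt (hU.mem_nhds hx)
  -- level one: `⟪ω, ∇m⟫ ≡ 0` on `I × U`
  have hlev1 : ∀ s ∈ I, ∀ z ∈ U, inner ℝ (curl (v s) z) (gradient (m s) z) = 0 :=
    viscous_level_one hI hU hv hp hns hdiv hunthr
  -- Ertel with source at level 1
  have hE := ertel_commutation (u := v) (B := fun s z => curl (v s) z) (θ := m) hI hU hv hB hm t ht x hx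
  rw [vorticity_transport_viscous hI hU hv hp hns hdiv t ht x hx] at hE
  have hev_t : (fun s => inner ℝ (curl (v s) x) (gradient (m s) x)) =ᶠ[𝓝 t] fun _ => (0 : ℝ) := by
    filter_upwards [hI.mem_nhds ht] with s hs using hlev1 s hs x hx
  have hev_x : (fun z => inner ℝ (curl (v t) z) (gradient (m t) z)) =ᶠ[𝓝 x] fun _ => (0 : ℝ) := by
    filter_upwards [hU.mem_nhds hx] with z hz using hlev1 t ht z hz
  have h1 : deriv (fun s => inner ℝ (curl (v s) x) (gradient (m s) x)) t = 0 := by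
    rw [hev_t.deriv_eq, deriv_const]
  have h2 : gradient (fun z => inner ℝ (curl (v t) z) (gradient (m t) z)) x = 0 := by
    rw [(gradient_congr_nhds hev_x).eq_of_nhds]
    simp [gradient]
  rw [h1, h2, inner_zero_right, add_zero] at hE
  -- `hE : 0 = ⟪ω, ∇(Dₜ m)⟫ + ⟪Δω, ∇m⟫`
  -- Leibniz: `0 = Δ⟪ω, ∇m⟫ = ⟪Δω, ∇m⟫ + ⟪ω, Δ∇m⟫ + 2 Σᵢ ⟪∂ᵢω, ∂ᵢ∇m⟫`, and `Δ∇m = ∇Δm`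
  have hL := laplacian_inner_of_contDiffOn (F := curl (v t)) (G := gradient (m t)) hU hωU hgradmU hx
  have h0 : Laplacian.laplacian (fun y => inner ℝ (curl (v t) y) (gradient (m t) y)) x = 0 := by
    rw [(InnerProductSpace.laplacian_congr_nhds hev_x).eq_of_nhds]
    simp
  rw [h0, laplacian_gradient_of_contDiffOn hU hmU hx, sum_inner_fderiv_gradient_eq hωd hgradmd] at hL
  -- split the gradient of the difference `Dₜm − Δm`
  have hA : DifferentiableAt ℝ (fun z => deriv (fun s => m s z) t + inner ℝ (v t z) (gradient (m t) z)) x := by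
    have h := contDiffOn_slice (contDiffOn_succ hv hm hI hU) ht
    exact (h.differentiableOn (by simp)).differentiableAt (hU.mem_nhds hx)
  obtain ⟨g, hg, hmg⟩ := exists_contDiff_eventuallyEq hU hmU hx
  have hΔev : Laplacian.laplacian (m t) =ᶠ[𝓝 x] Laplacian.laplacian g := InnerProductSpace.laplacian_congr_nhds hmg
  have hC : DifferentiableAt ℝ (Laplacian.laplacian (m t)) x := by
    refine DifferentiableAt.congr_of_eventuallyEq ?_ hΔev
    have hΔg : ContDiff ℝ 1 (Laplacian.laplacian g) := contDiff_laplacian (n := 1) (hg.of_le (by norm_cast))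
    exact hΔg.differentiable (by simp) x
  have hsplit : gradient (fun z => deriv (fun s => m s z) t + inner ℝ (v t z) (gradient (m t) z)
        - Laplacian.laplacian (m t) z) x
      = gradient (fun z => deriv (fun s => m s z) t + inner ℝ (v t z) (gradient (m t) z)) x
        - gradient (Laplacian.laplacian (m t)) x := by
    rw [gradient, gradient, gradient, ← map_sub, fderiv_fun_sub hA hC]
  show inner ℝ (curl (v t) x)
      (gradient (fun z => deriv (fun s => m s z) t + inner ℝ (v t z) (gradient (m t) z)
        - Laplacian.laplacian (m t) z) x) = _
  rw [hsplit, inner_sub_right]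
  linarith

/-- ★ **`ViscousLevelTwoLaw` (ErtelTowerSketch Part B) is a theorem** — the first VISCOUS statement of the radial-jerk
tower: `⟪ω, ∇((∂ₜ + v·∇ − Δ) m)⟫ = 2 Σᵢⱼ ∂ᵢωⱼ ∂ᵢ∂ⱼ m` for every smooth unthreaded Navier–Stokes flow on an open
space-time set (`viscous_level_two`). -/
theorem viscousLevelTwoLaw : ViscousLevelTwoLaw := by
  intro v p x₀ I U hI hU hv hp hns hdiv hunthr t ht x hx
  exact viscous_level_two hI hU hv hp hns hdiv hunthr t ht x hx

end Viscous

end Summit.NavierStokesRegularity.NavierStokesRegularity.Theorems.PoloidalLiouville.ErtelTower
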